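import Literature.NumberTheory.EllipticCurves.FunctionFieldDescentSequenceProofs
import Literature.NumberTheory.EllipticCurves.FunctionFieldNorthcottProofs
import Literature.NumberTheory.EllipticCurves.DescentTheorem
import Mathlib.GroupTheory.FiniteAbelian.Basic
import HarnessLib

/-!
# The Mordell–Weil–Lang–Néron theorem for elliptic curves over global function fields

A *proofs* file (theorems only; D-0014/D-0026) of the provefact seat (approach B) of
`Literature.NumberTheory.EllipticCurves.analyticRank_eq_iff_finite_sha` (bsd.S33), whose
statement is phrased with `WeierstrassCurve.mordellWeilRank W = rank_ℤ E(F)` (`Module.finrank`,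
junk `0` unless `E(F)` is finitely generated). We prove, for an elliptic curve `E` (Weierstrass
curve `W` with `Δ ≠ 0`) over a **global function field** `F ⊇ 𝔽_q(t)`:

* `addGroup_fg_point_of_functionField`, `module_finite_point_of_functionField` — **`E(F)` is a
  finitely generated abelian group** (Lang–Néron 1959; Ulmer (2011), Lecture 1, Thm. 5.1:
  "`E(K)` is a finitely generated abelian group", with the proof outline of §5 — weak
  Mordell–Weil for `ℓ ≠ p` by "an argument very similar to the proof of the weak Mordell–Weil
  theorem over number fields", then "a theory of heights exactly as in [Silverman] … to finish the
  proof"). The Lean proof follows exactly this outline, i.e. Silverman's proof of *AEC*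
  Thm. VIII.6.7 transported to `F`: the descent theorem VIII.3.1
  (`MordellWeil.descent_theorem_holds`) applied to the naive height `h = naiveHeight q W`
  (`h(x, y) = log q · deg (x)_∞`) with `m = 2` (or `m = 3` in characteristic `2`), whose
  hypotheses are (i)/(ii) the height inequalities from the approximate parallelogram law
  VIII.6.2 over `F` (`hasApproxParallelogramLaw_naiveHeight_holds`,
  `FunctionFieldEllipticLHeightsProofs`), (iii) Northcott's finiteness
  (`finite_setOf_naiveHeight_le`, `FunctionFieldNorthcottProofs`) and (iv) the weak
  Mordell–Weil theorem `#E(F)/mE(F) < ∞` for `m` invertible in `F`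
  (`finite_quotient_range_nsmul`, `FunctionFieldDescentSequenceProofs`: Kummer sequence over the
  imperfect field `F` and finiteness of the `m`-Selmer group);
* `finite_torsion_of_functionField` — `E(F)_tors` is finite;
* `exists_isMordellWeilBasis_of_functionField` — `E(F)` has a Mordell–Weil basis
  `P₁, …, P_r`, `r = rank_ℤ E(F)` (`WeierstrassCurve.IsMordellWeilBasis`), so that
  `Literature.FunctionField.regulator q W` is the regulator of an actual basis.

On the named facts `FunctionField.module_finite_point`, `FunctionField.exists_isMordellWeilBasis`,
`FunctionField.finite_torsion` of `FunctionFieldEllipticL` (section `FunctionField`): as recorded in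
that file's module docstring ("Corrected statements") and in `FunctionFieldSelmer`, the `include Fq`
of their section does not reach `def`s, so these three `Prop`s elaborate with binders
`{F : Type} [Field F] (W : WeierstrassCurve F)` only — they assert finite generation of `E(F)` for
an elliptic curve over an **arbitrary** field, which is false (e.g. `F = ℂ`), and cannot be
discharged as stated. The theorems below are their corrected forms (the global-function-field
structure as hypotheses, bodies unchanged), named `…_of_functionField` like the corrected
`L`-function facts of that file; no definition is touched here.

## References

* [LangNeron1959AJM] S. Lang, A. Néron, *Rational points of abelian varieties over function
  fields*, Amer. J. Math. 81 (1959), 95–118 (Thm. 1: finite generation of `A(K)` modulo the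
  `K/k`-trace; for `k` finite the trace part `τB(k)` is finite).
* [Ulmer2011ParkCity] D. Ulmer, *Elliptic curves over function fields*, IAS/Park City Math. Ser.
  18 (2011), Lecture 1, Thm. 5.1 and §5 (arXiv:1101.1939, p. 9); Lecture 3, §§3–4.
* [SilvermanAEC2009] J. H. Silverman, *The Arithmetic of Elliptic Curves*, 2nd ed. (2009),
  Thm. VIII.3.1, Thm. VIII.6.7 and its proof, VIII.6 (Mordell–Weil bases).
-/

noncomputable section

open scoped Classical Polynomial

namespace Literature.NumberTheory.EllipticCurves.FunctionField

open WeierstrassCurve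

variable {F : Type} [Field F] (W : WeierstrassCurve F)

/-! ## Height inequalities from the approximate parallelogram law -/

/-- The naive height `h(x, y) = log q · ∑_v max(0, -ord_v x) deg v` is nonnegative. [folklore] -/
theorem naiveHeight_nonneg (q : ℕ) (P : W.toAffine.Point) : 0 ≤ naiveHeight q W P := by
  rcases P with _ | ⟨x, y, h⟩
  · exact le_of_eq (naiveHeight_zero W q).symm
  · change 0 ≤ Real.log q * ∑ᶠ v : Place F, ((max 0 (-(v.ord x)) * (v.degree q : ℤ) : ℤ) : ℝ)
    refine mul_nonneg (Real.log_natCast_nonneg q) (finsum_nonneg fun v => ?_)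
    exact_mod_cast mul_nonneg (le_max_left _ _) (Int.natCast_nonneg _)

/-- Hypothesis (i) of the descent theorem for the naive height: `h(P + Q) ≤ 2 h(P) + C₁(Q)`
(Silverman, *AEC*, VIII.6.4(a) ⇐ VIII.6.2: the approximate parallelogram law and `h(P - Q) ≥ 0`,
with `C₁ = 2 h(Q) + C`). [cite: SilvermanAEC2009, Thm. VIII.6.2 and Lemma VIII.6.4(a)] -/
theorem exists_naiveHeight_add_le (q : ℕ)
    (hpar : DiophantineGeometry.HasApproxParallelogramLaw (naiveHeight q W))
    (Q : W.toAffine.Point) :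
    ∃ C₁ : ℝ, ∀ P : W.toAffine.Point, naiveHeight q W (P + Q) ≤ 2 * naiveHeight q W P + C₁ := by
  obtain ⟨C, hC⟩ := hpar
  refine ⟨2 * naiveHeight q W Q + C, fun P => ?_⟩
  have h := (abs_le.mp (hC P Q)).2
  have h0 := naiveHeight_nonneg W q (P - Q)
  linarith

/-- Hypothesis (ii) of the descent theorem with `m = 2`: `h(2P) ≥ 4 h(P) - C₂` (Silverman, *AEC*,
VIII.6.4(b) ⇐ VIII.6.2 with `Q = P`, as `h(O) = 0`). [cite: SilvermanAEC2009, Lemma VIII.6.4(b)] -/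
theorem exists_naiveHeight_two_nsmul_ge (q : ℕ)
    (hpar : DiophantineGeometry.HasApproxParallelogramLaw (naiveHeight q W)) :
    ∃ C₂ : ℝ, ∀ P : W.toAffine.Point,
      ((2 : ℕ) : ℝ) ^ 2 * naiveHeight q W P - C₂ ≤ naiveHeight q W ((2 : ℕ) • P) := by
  obtain ⟨C, hC⟩ := hpar
  refine ⟨C, fun P => ?_⟩
  have h := (abs_le.mp (hC P P)).1
  rw [sub_self, naiveHeight_zero, ← two_nsmul] at h
  norm_num
  linarith

/-- Hypothesis (ii) of the descent theorem with `m = 3` (needed in characteristic `2`):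
`h(3P) ≥ 9 h(P) - C₂`, from the parallelogram law at `(2P, P)` and at `(P, P)`.
[cite: SilvermanAEC2009, Lemma VIII.6.4(b)] -/
theorem exists_naiveHeight_three_nsmul_ge (q : ℕ)
    (hpar : DiophantineGeometry.HasApproxParallelogramLaw (naiveHeight q W)) :
    ∃ C₂ : ℝ, ∀ P : W.toAffine.Point,
      ((3 : ℕ) : ℝ) ^ 2 * naiveHeight q W P - C₂ ≤ naiveHeight q W ((3 : ℕ) • P) := by
  obtain ⟨C, hC⟩ := hpar
  refine ⟨3 * C, fun P => ?_⟩
  have h1 := (abs_le.mp (hC P P)).1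
  rw [sub_self, naiveHeight_zero, ← two_nsmul] at h1
  have h2 := (abs_le.mp (hC ((2 : ℕ) • P) P)).1
  rw [show (2 : ℕ) • P + P = (3 : ℕ) • P from (succ_nsmul P 2).symm,
    show (2 : ℕ) • P - P = P by rw [two_nsmul, add_sub_cancel_right]] at h2
  norm_num
  linarith

/-- Pure algebra (any field): a `ℤ`-basis `b` of `E(K)/E(K)_tors` lifts to a Mordell–Weil basis.
[folklore] -/
private theorem isMordellWeilBasis_of_basis' {ι : Type*}
    (b : Module.Basis ι ℤ (mordellWeilModTorsion W)) (P : ι → W.toAffine.Point)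
    (hP : (QuotientAddGroup.mk ∘ P : ι → mordellWeilModTorsion W) = b) :
    IsMordellWeilBasis P := by
  refine ⟨?_, ?_⟩
  · rw [hP]; exact b.linearIndependent
  · rw [hP]; exact b.span_eq

/-- The number of elements of any finite Mordell–Weil basis is
`rank_ℤ E(K) = WeierstrassCurve.mordellWeilRank W` (well-definedness of the rank, over any field;
the tree's `IsMordellWeilBasis.card_eq_holds` has the same proof but is bound to number fields).
In particular the basis of `exists_isMordellWeilBasis_of_functionField` has `rank_ℤ E(F)`
elements. [cite: SilvermanAEC2009, VIII.6] -/
theorem IsMordellWeilBasis.card_eq_mordellWeilRank {ι : Type*} [Fintype ι]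
    {P : ι → W.toAffine.Point} (h : IsMordellWeilBasis P) :
    Fintype.card ι = W.mordellWeilRank := by
  obtain ⟨hli, hsp⟩ := h
  have b : Module.Basis ι ℤ (mordellWeilModTorsion W) := Module.Basis.mk hli hsp.ge
  -- `rank (E(K)/tors) = rank E(K)`
  let f : W.toAffine.Point →ₗ[ℤ] mordellWeilModTorsion W :=
    (QuotientAddGroup.mk' (AddCommGroup.torsion W.toAffine.Point)).toIntLinearMap
  have hf : Function.Surjective f :=
    QuotientAddGroup.mk'_surjective (AddCommGroup.torsion W.toAffine.Point)
  have hker : LinearMap.ker f ≤ Submodule.torsion ℤ W.toAffine.Point := by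
    intro x hx
    have hx' : x ∈ AddCommGroup.torsion W.toAffine.Point :=
      (QuotientAddGroup.eq_zero_iff x).mp (LinearMap.mem_ker.mp hx)
    rwa [← Submodule.torsion_int] at hx'
  have h1 : Module.finrank ℤ (mordellWeilModTorsion W) = Fintype.card ι :=
    Module.finrank_eq_card_basis b
  have h2 : Module.finrank ℤ (mordellWeilModTorsion W) = Module.finrank ℤ W.toAffine.Point := by
    rw [← (f.quotKerEquivOfSurjective hf).finrank_eq]
    exact finrank_quotient_eq_of_le_torsion hker
  rw [mordellWeilRank, ← h2, h1]

/-! ## Lang–Néron: `E(F)` is finitely generated -/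

section GlobalFunctionField

variable (Fq : Type) [Field Fq] [Fintype Fq] [Algebra Fq[X] F] [Algebra (RatFunc Fq) F]
  [IsScalarTower Fq[X] (RatFunc Fq) F] [FunctionField Fq F]

include Fq

/-- **The Mordell–Weil–Lang–Néron theorem for elliptic curves over global function fields, group
form** (Lang–Néron 1959; Ulmer (2011), Lecture 1, Thm. 5.1; proof = Silverman's proof of *AEC*
Thm. VIII.6.7 over `F`): for an elliptic curve `E` over a global function field `F ⊇ 𝔽_q(t)`, the
group `E(F)` is finitely generated. The descent theorem VIII.3.1
(`MordellWeil.descent_theorem_holds`) is applied to the naive height `h(x, y) = log q · deg (x)_∞`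
with `m = 2` if `2 ≠ 0` in `F` and `m = 3` otherwise: (i) `h(P + Q) ≤ 2 h(P) + C₁(Q)` and
(ii) `h(mP) ≥ m² h(P) - C₂` from the approximate parallelogram law over `F`
(`hasApproxParallelogramLaw_naiveHeight_holds`), (iii) `{P | h(P) ≤ C₃}` finite
(`finite_setOf_naiveHeight_le`), and `E(F)/mE(F)` finite — the weak Mordell–Weil theorem for `m`
invertible in `F` (`finite_quotient_range_nsmul`). [cite: Ulmer2011ParkCity, Lecture 1, Thm. 5.1]
[cite: LangNeron1959AJM, Thm. 1] [cite: SilvermanAEC2009, Thm. VIII.6.7 (proof)] -/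
theorem addGroup_fg_point_of_functionField [W.IsElliptic] : AddGroup.FG W.toAffine.Point := by
  have hpar : DiophantineGeometry.HasApproxParallelogramLaw (naiveHeight (Fintype.card Fq) W) :=
    hasApproxParallelogramLaw_naiveHeight_holds Fq W
  have h1 := exists_naiveHeight_add_le W (Fintype.card Fq) hpar
  have h3 := finite_setOf_naiveHeight_le Fq W
  by_cases h2F : (2 : F) = 0
  · -- characteristic `2`: use `m = 3` (`3 = 1 ≠ 0` in `F`)
    have h3F : ((3 : ℕ) : F) ≠ 0 := by
      rw [show ((3 : ℕ) : F) = 2 + 1 by norm_num, h2F, zero_add]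
      exact one_ne_zero
    exact MordellWeil.descent_theorem_holds W.toAffine.Point (naiveHeight (Fintype.card Fq) W) 3
      (by norm_num) h1 (exists_naiveHeight_three_nsmul_ge W _ hpar) h3
      (finite_quotient_range_nsmul W Fq h3F)
  · have h2F' : ((2 : ℕ) : F) ≠ 0 := by exact_mod_cast h2F
    exact MordellWeil.descent_theorem_holds W.toAffine.Point (naiveHeight (Fintype.card Fq) W) 2
      le_rfl h1 (exists_naiveHeight_two_nsmul_ge W _ hpar) h3
      (finite_quotient_range_nsmul W Fq h2F')

/-- **The Mordell–Weil–Lang–Néron theorem, module form**: for an elliptic curve over a global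
function field, `E(F)` is a finite `ℤ`-module — the corrected form of the named fact
`FunctionField.module_finite_point` (same body, the function-field structure as hypotheses; see
the module docstring). In particular `WeierstrassCurve.mordellWeilRank W = rank_ℤ E(F)` is the
genuine rank. [cite: Ulmer2011ParkCity, Lecture 1, Thm. 5.1] [cite: LangNeron1959AJM, Thm. 1] -/
theorem module_finite_point_of_functionField [W.IsElliptic] : Module.Finite ℤ W.toAffine.Point :=
  Module.Finite.iff_addGroup_fg.mpr (addGroup_fg_point_of_functionField W Fq)

/-- **`E(F)_tors` is finite** for an elliptic curve over a global function field (the torsion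
subgroup of a finitely generated abelian group is finite) — the corrected form of the named fact
`FunctionField.finite_torsion`. Ulmer (2011), Lecture 1, Thm. 5.1 and §6.
[cite: Ulmer2011ParkCity, Lecture 1, Thm. 5.1] -/
theorem finite_torsion_of_functionField [W.IsElliptic] :
    Finite (AddCommGroup.torsion W.toAffine.Point) := by
  haveI : Module.Finite ℤ W.toAffine.Point := module_finite_point_of_functionField W Fq
  haveI : Module.Finite ℤ (Submodule.torsion ℤ W.toAffine.Point) :=
    Module.Finite.of_injective (Submodule.torsion ℤ W.toAffine.Point).subtype
      Subtype.val_injective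
  have hT : Module.IsTorsion ℤ (Submodule.torsion ℤ W.toAffine.Point) := fun y => by
    obtain ⟨a, ha⟩ := (Submodule.mem_torsion_iff y.1).mp y.2
    exact ⟨a, Subtype.ext ha⟩
  haveI : Finite (Submodule.torsion ℤ W.toAffine.Point) := Module.finite_of_fg_torsion _ hT
  have hmem : ∀ x : AddCommGroup.torsion W.toAffine.Point,
      (x : W.toAffine.Point) ∈ Submodule.torsion ℤ W.toAffine.Point := fun x => by
    have hx : x.1 ∈ (Submodule.torsion ℤ W.toAffine.Point).toAddSubgroup := by
      rw [Submodule.torsion_int]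
      exact x.2
    exact hx
  refine Finite.of_injective (fun x : AddCommGroup.torsion W.toAffine.Point =>
    (⟨x.1, hmem x⟩ : Submodule.torsion ℤ W.toAffine.Point)) fun x y hxy => ?_
  apply Subtype.ext
  have h := congrArg (fun z : Submodule.torsion ℤ W.toAffine.Point => (z : W.toAffine.Point)) hxy
  simpa using h

/-- **Existence of a Mordell–Weil basis over a global function field**: an elliptic curve over a
global function field `F` admits points `P₁, …, P_r ∈ E(F)`, `r = rank_ℤ E(F)`, whose classes form
a `ℤ`-basis of `E(F)/E(F)_tors` — the corrected form of the named fact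
`FunctionField.exists_isMordellWeilBasis` (Lang–Néron with the structure theorem of finitely
generated abelian groups: `E(F)/E(F)_tors` is free of rank `r`; Silverman, *AEC*, VIII.6; Ulmer
(2011), Lecture 1, Thm. 5.1). [cite: Ulmer2011ParkCity, Lecture 1, Thm. 5.1]
[cite: SilvermanAEC2009, VIII.6] -/
theorem exists_isMordellWeilBasis_of_functionField [W.IsElliptic] :
    ∃ (n : ℕ) (P : Fin n → W.toAffine.Point), IsMordellWeilBasis P := by
  haveI : Module.Finite ℤ W.toAffine.Point := module_finite_point_of_functionField W Fq
  let f : W.toAffine.Point →ₗ[ℤ] mordellWeilModTorsion W :=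
    (QuotientAddGroup.mk' (AddCommGroup.torsion W.toAffine.Point)).toIntLinearMap
  have hf : Function.Surjective f :=
    QuotientAddGroup.mk'_surjective (AddCommGroup.torsion W.toAffine.Point)
  haveI : Module.Finite ℤ (mordellWeilModTorsion W) := Module.Finite.of_surjective f hf
  haveI : Module.Free ℤ (mordellWeilModTorsion W) := inferInstance
  let n := Module.finrank ℤ (mordellWeilModTorsion W)
  let b : Module.Basis (Fin n) ℤ (mordellWeilModTorsion W) :=
    Module.finBasisOfFinrankEq ℤ (mordellWeilModTorsion W) rfl
  have hlift : ∀ i : Fin n, ∃ P : W.toAffine.Point,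
      (QuotientAddGroup.mk P : mordellWeilModTorsion W) = b i :=
    fun i => QuotientAddGroup.mk_surjective (b i)
  choose P hP using hlift
  exact ⟨n, P, isMordellWeilBasis_of_basis' W b P (funext hP)⟩

end GlobalFunctionField

end Literature.NumberTheory.EllipticCurves.FunctionField

end
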